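import Mathlib
import HarnessLib

/-!
# Route `SlackWindow`, crux `CarrierSlackLargeMirrorCeiling` (stmt-QuantumFields-23686), LINE 1 «PlancherelCovering»
# (planner ym-idea-11 g12): elementary lemmas for the Plancherel covering (stub `stub_plancherelCovering`)

Pure-Mathlib bookkeeping for summing the wave-packet reflection-positivity squares over the full torus momentum grid
`box₃ L = [-L, L]³ ⊂ ℤ³` of the odd torus `2L+1`:
* `sum_Icc_exp_eq` — character orthogonality on one coordinate: `Σ_{k=-L}^{L} e^{2πi k z/(2L+1)} = (2L+1)·[(2L+1) ∣ z]`;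
* `sum_box_cos_eq` — its real three-dimensional form: `Σ_{n ∈ box₃ L} cos(2π n·z/(2L+1)) = (2L+1)³·[∀ j, (2L+1) ∣ z_j]`;
* `int_dvd_sub_iff_of_abs_le` — inside the box divisibility of a difference by `2L+1` is equality;
* `sum_Icc_inv_one_add_mul_abs_sq_le` — the telescoping bound `Σ_{k=-L}^{L} (1 + a|k|)⁻² ≤ 1 + 2/a` (`a > 0`);
* `exists_transverse_bump` — a smooth transverse profile `b` on `ℝ³`: compact support in the closed unit ball, `0 ≤ b`, `b = 1` on the
  ball of radius `1/2` (`ContDiffBump`, `HasCompactSupport.toSchwartzMap`).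
Width seat `ym-line-sfw-p2-w4` g19 (cell ym-idea-1; free hands), `--supports stmt-QuantumFields-23686`.  No route item, rung or summit is
proved here. [folklore]
-/

set_option autoImplicit false

namespace Summit.QuantumFields.YangMills.Theorems.SlackWindowPlancherelCovering

open Finset

/-- **Character orthogonality on `[-L, L]`**: `Σ_{k=-L}^{L} exp(2πi k z/(2L+1)) = 2L+1` if `(2L+1) ∣ z`, and `0` otherwise.
[folklore] -/
theorem sum_Icc_exp_eq (L : ℕ) (z : ℤ) :
    ∑ k ∈ Icc (-(L : ℤ)) L, Complex.exp (2 * Real.pi * Complex.I * ((k : ℂ) * (z : ℂ) / (2 * (L : ℂ) + 1))) =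
      if (2 * (L : ℤ) + 1) ∣ z then (2 * (L : ℂ) + 1) else 0 := by
  have hN0 : (2 * (L : ℂ) + 1) ≠ 0 := by
    have : (2 * (L : ℂ) + 1) = ((2 * L + 1 : ℕ) : ℂ) := by push_cast; ring
    rw [this]; exact Nat.cast_ne_zero.2 (by omega)
  -- the primitive phase
  set ζ : ℂ := Complex.exp (2 * Real.pi * Complex.I * ((z : ℂ) / (2 * (L : ℂ) + 1))) with hζ
  have hterm : ∀ k : ℤ, Complex.exp (2 * Real.pi * Complex.I * ((k : ℂ) * (z : ℂ) / (2 * (L : ℂ) + 1))) = ζ ^ k := by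
    intro k
    rw [hζ, ← Complex.exp_int_mul]
    congr 1; ring
  simp_rw [hterm]
  -- reindex `[-L, L]` by `j = k + L ∈ [0, 2L]`
  have hre : ∑ k ∈ Icc (-(L : ℤ)) L, ζ ^ k = ∑ j ∈ range (2 * L + 1), ζ ^ ((j : ℤ) - L) := by
    refine Finset.sum_nbij' (fun k : ℤ => (k + L).toNat) (fun j : ℕ => (j : ℤ) - L) ?_ ?_ ?_ ?_ ?_
    · intro a ha; simp only [mem_Icc] at ha; simp only [mem_range]; omega
    · intro a ha; simp only [mem_range] at ha; simp only [mem_Icc]; omega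
    · intro a ha; simp only [mem_Icc] at ha; omega
    · intro a ha; simp only [mem_range] at ha; omega
    · intro a ha; simp only [mem_Icc] at ha; congr 1; omega
  rw [hre]
  by_cases hdvd : (2 * (L : ℤ) + 1) ∣ z
  · -- every term is `1`
    rw [if_pos hdvd]
    obtain ⟨m, hm⟩ := hdvd
    have hζ1 : ζ = 1 := by
      rw [hζ, Complex.exp_eq_one_iff]
      refine ⟨m, ?_⟩
      rw [hm]; push_cast; field_simp
    simp [hζ1]
  · rw [if_neg hdvd]
    have hζne : ζ ≠ 1 := by
      rw [hζ, Ne, Complex.exp_eq_one_iff]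
      rintro ⟨m, hm⟩
      apply hdvd
      have hπ : (2 * Real.pi * Complex.I : ℂ) ≠ 0 := by simp [Real.pi_ne_zero, Complex.I_ne_zero]
      have h2 : (z : ℂ) / (2 * (L : ℂ) + 1) = m := by
        rw [mul_comm (m : ℂ)] at hm
        exact mul_left_cancel₀ hπ hm
      rw [div_eq_iff hN0] at h2
      refine ⟨m, ?_⟩
      have h3 : (z : ℂ) = (((2 * (L : ℤ) + 1) * m : ℤ) : ℂ) := by rw [h2]; push_cast; ring
      exact_mod_cast h3
    have hζN : ζ ^ (2 * L + 1) = 1 := by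
      rw [hζ, ← Complex.exp_nat_mul, Complex.exp_eq_one_iff]
      refine ⟨z, ?_⟩
      push_cast; field_simp
    have hζ0 : ζ ≠ 0 := Complex.exp_ne_zero _
    have hsplit : ∀ j : ℕ, ζ ^ ((j : ℤ) - L) = ζ ^ (-(L : ℤ)) * ζ ^ j := by
      intro j
      rw [zpow_sub₀ hζ0, zpow_natCast, zpow_neg, zpow_natCast, div_eq_mul_inv, mul_comm]
    simp_rw [hsplit, ← Finset.mul_sum, geom_sum_eq hζne, hζN]
    simp

/-- Inside the box `[-L, L]` divisibility of a difference by `2L+1` is equality. [folklore] -/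
theorem int_dvd_sub_iff_of_abs_le {L : ℕ} {x y : ℤ} (hx : |x| ≤ L) (hy : |y| ≤ L) :
    (2 * (L : ℤ) + 1) ∣ (x - y) ↔ x = y := by
  constructor
  · rintro ⟨m, hm⟩
    have h1 := abs_le.1 hx
    have h2 := abs_le.1 hy
    rcases lt_trichotomy m 0 with hm0 | hm0 | hm0
    · nlinarith
    · rw [hm0, mul_zero] at hm; omega
    · nlinarith
  · rintro rfl; simp

/-- **Real three-dimensional character orthogonality on the momentum box** `box₃ L = [-L, L]³`:
`Σ_{n ∈ box₃ L} cos(2π (Σ_j n_j z_j)/(2L+1)) = (2L+1)³` if `(2L+1) ∣ z_j` for every `j`, and `0` otherwise. [folklore] -/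
theorem sum_box_cos_eq (L : ℕ) (z : Fin 3 → ℤ) :
    ∑ n ∈ Fintype.piFinset (fun _ : Fin 3 => Icc (-(L : ℤ)) (L : ℤ)),
        Real.cos (2 * Real.pi * (∑ j, (n j : ℝ) * (z j : ℝ)) / (2 * (L : ℝ) + 1)) =
      if ∀ j, (2 * (L : ℤ) + 1) ∣ z j then (2 * (L : ℝ) + 1) ^ 3 else 0 := by
  -- pass to the complex exponential
  have hcos : ∀ n : Fin 3 → ℤ, Real.cos (2 * Real.pi * (∑ j, (n j : ℝ) * (z j : ℝ)) / (2 * (L : ℝ) + 1)) =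
      (∏ j, Complex.exp (2 * Real.pi * Complex.I * ((n j : ℂ) * (z j : ℂ) / (2 * (L : ℂ) + 1)))).re := by
    intro n
    rw [← Complex.exp_sum]
    have : ∑ j, 2 * Real.pi * Complex.I * ((n j : ℂ) * (z j : ℂ) / (2 * (L : ℂ) + 1)) =
        ((2 * Real.pi * (∑ j, (n j : ℝ) * (z j : ℝ)) / (2 * (L : ℝ) + 1) : ℝ) : ℂ) * Complex.I := by
      push_cast
      rw [Finset.mul_sum, Finset.sum_div, Finset.sum_mul]
      refine Finset.sum_congr rfl fun j _ => ?_
      ring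
    rw [this, Complex.exp_ofReal_mul_I_re]
  simp_rw [hcos]
  rw [← Complex.re_sum, Finset.sum_prod_piFinset _
    (fun j (k : ℤ) => Complex.exp (2 * Real.pi * Complex.I * ((k : ℂ) * (z j : ℂ) / (2 * (L : ℂ) + 1)))),
    Finset.prod_congr rfl fun j _ => sum_Icc_exp_eq L (z j)]
  by_cases h : ∀ j, (2 * (L : ℤ) + 1) ∣ z j
  · rw [if_pos h]
    simp only [h, if_true, Finset.prod_const, Finset.card_univ, Fintype.card_fin]
    norm_cast
  · rw [if_neg h]
    push Not at h
    obtain ⟨j, hj⟩ := h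
    rw [Finset.prod_eq_zero (Finset.mem_univ j) (by rw [if_neg hj])]
    simp

/-- **Telescoping bound**: for `a > 0`, `Σ_{k=-L}^{L} (1 + a|k|)⁻² ≤ 1 + 2/a`
(each term `k ≠ 0` is at most `(1/a)(1/(1 + a(|k|−1)) − 1/(1 + a|k|))`). [folklore] -/
theorem sum_Icc_inv_one_add_mul_abs_sq_le (L : ℕ) {a : ℝ} (ha : 0 < a) :
    ∑ k ∈ Icc (-(L : ℤ)) L, ((1 + a * |(k : ℝ)|) ^ 2)⁻¹ ≤ 1 + 2 / a := by
  -- positive part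
  have hpos : ∀ K : ℕ, ∑ k ∈ range K, ((1 + a * ((k + 1 : ℕ) : ℝ)) ^ 2)⁻¹ ≤ 1 / a * (1 - 1 / (1 + a * K)) := by
    intro K
    induction K with
    | zero => simp
    | succ K ih =>
      rw [Finset.sum_range_succ]
      have hK : (0 : ℝ) ≤ K := Nat.cast_nonneg K
      have h1 : 0 < 1 + a * K := by positivity
      have h2 : 0 < 1 + a * ((K + 1 : ℕ) : ℝ) := by positivity
      have hstep : ((1 + a * ((K + 1 : ℕ) : ℝ)) ^ 2)⁻¹ ≤ 1 / a * (1 / (1 + a * K) - 1 / (1 + a * ((K + 1 : ℕ) : ℝ))) := by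
        have hrhs : 1 / a * (1 / (1 + a * K) - 1 / (1 + a * ((K + 1 : ℕ) : ℝ))) =
            1 / ((1 + a * K) * (1 + a * ((K + 1 : ℕ) : ℝ))) := by
          field_simp
          push_cast
          ring
        rw [hrhs, inv_eq_one_div]
        apply one_div_le_one_div_of_le (by positivity)
        have hle : 1 + a * (K : ℝ) ≤ 1 + a * ((K + 1 : ℕ) : ℝ) := by push_cast; nlinarith
        nlinarith [h2]
      calc ∑ k ∈ range K, ((1 + a * ((k + 1 : ℕ) : ℝ)) ^ 2)⁻¹ + ((1 + a * ((K + 1 : ℕ) : ℝ)) ^ 2)⁻¹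
          ≤ 1 / a * (1 - 1 / (1 + a * K)) + 1 / a * (1 / (1 + a * K) - 1 / (1 + a * ((K + 1 : ℕ) : ℝ))) :=
            add_le_add ih hstep
        _ = 1 / a * (1 - 1 / (1 + a * ((K + 1 : ℕ) : ℝ))) := by ring
  have hpos' : ∀ K : ℕ, ∑ k ∈ range K, ((1 + a * ((k + 1 : ℕ) : ℝ)) ^ 2)⁻¹ ≤ 1 / a := by
    intro K
    refine (hpos K).trans ?_
    have : 0 ≤ 1 / (1 + a * (K : ℝ)) := by positivity
    nlinarith [one_div_pos.2 ha]
  -- split `[-L, L] = {0} ∪ [1, L] ∪ [-L, -1]`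
  have hsplit : ∑ k ∈ Icc (-(L : ℤ)) L, ((1 + a * |(k : ℝ)|) ^ 2)⁻¹ =
      1 + (∑ k ∈ range L, ((1 + a * ((k + 1 : ℕ) : ℝ)) ^ 2)⁻¹) + ∑ k ∈ range L, ((1 + a * ((k + 1 : ℕ) : ℝ)) ^ 2)⁻¹ := by
    have hdecomp : Icc (-(L : ℤ)) L = {0} ∪ ((range L).image fun k : ℕ => ((k : ℤ) + 1)) ∪
        ((range L).image fun k : ℕ => -((k : ℤ) + 1)) := by
      ext k
      simp only [mem_Icc, mem_union, mem_singleton, mem_image, mem_range]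
      constructor
      · intro hk
        rcases lt_trichotomy k 0 with h | h | h
        · right; exact ⟨(-k - 1).toNat, by omega, by omega⟩
        · left; left; exact h
        · left; right; exact ⟨(k - 1).toNat, by omega, by omega⟩
      · rintro ((rfl | ⟨j, hj, rfl⟩) | ⟨j, hj, rfl⟩) <;> omega
    rw [hdecomp, Finset.sum_union, Finset.sum_union, Finset.sum_singleton, Finset.sum_image, Finset.sum_image]
    · simp only [Int.cast_zero, abs_zero, mul_zero, add_zero, one_pow, inv_one]
      congr 1
      · congr 1
        refine Finset.sum_congr rfl fun k _ => ?_
        congr 2; push_cast; rw [abs_of_nonneg (by positivity)]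
      · refine Finset.sum_congr rfl fun k _ => ?_
        congr 2; push_cast; rw [abs_neg, abs_of_nonneg (by positivity)]
    · intro x _ y _ h; simpa using h
    · intro x _ y _ h; simpa using h
    · rw [Finset.disjoint_left]
      simp only [mem_singleton, mem_image, mem_range, not_exists, not_and]
      rintro k rfl j _; omega
    · rw [Finset.disjoint_left]
      simp only [mem_union, mem_singleton, mem_image, mem_range, not_exists, not_and]
      rintro k hk j _ rfl
      rcases hk with h | ⟨i, _, hi⟩ <;> omega
  rw [hsplit]
  have := hpos' L
  have e : 1 + 2 / a = 1 + 1 / a + 1 / a := by ring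
  rw [e]
  linarith

/-- **A transverse wave-packet profile**: a smooth `b : ℝ³ → ℝ` with compact support in the closed unit ball, `0 ≤ b ≤ 1` and `b = 1` on
the closed ball of radius `1/2` (a `ContDiffBump` at `0` with radii `1/2 < 3/4`). [folklore] -/
theorem exists_transverse_bump : ∃ b : SchwartzMap (EuclideanSpace ℝ (Fin 3)) ℝ, HasCompactSupport b ∧
    tsupport (b : EuclideanSpace ℝ (Fin 3) → ℝ) ⊆ Metric.closedBall 0 1 ∧ (∀ u, 0 ≤ b u) ∧ (∀ u, b u ≤ 1) ∧
    ∀ u : EuclideanSpace ℝ (Fin 3), ‖u‖ ≤ 1 / 2 → b u = 1 := by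
  let φ : ContDiffBump (0 : EuclideanSpace ℝ (Fin 3)) := ⟨1 / 2, 3 / 4, by norm_num, by norm_num⟩
  refine ⟨φ.hasCompactSupport.toSchwartzMap φ.contDiff, φ.hasCompactSupport, ?_, fun u => φ.nonneg, fun u => φ.le_one,
    fun u hu => φ.one_of_mem_closedBall ?_⟩
  · intro u hu
    have h : u ∈ Metric.closedBall (0 : EuclideanSpace ℝ (Fin 3)) φ.rOut := by
      rw [← φ.tsupport_eq]; exact hu
    have h' : dist u 0 ≤ 3 / 4 := h
    rw [Metric.mem_closedBall]
    linarith
  · rw [Metric.mem_closedBall, dist_zero_right]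
    exact hu

/-- **Packet mass from below**: for a profile `b` with `b = 1` on the ball of radius `1/2`, `1 ≤ M ≤ L`,
`Σ_{x ∈ box₃ L} b(x/M)² ≥ (M/4)³` (the lattice cube `|x_j| ≤ ⌊M/4⌋` lies in `{b(·/M) = 1}` and has `(2⌊M/4⌋+1)³ ≥ (M/4)³` points).
[folklore] -/
theorem sum_box_sq_ge (L M : ℕ) (hM : 1 ≤ M) (hML : M ≤ L) (b : EuclideanSpace ℝ (Fin 3) → ℝ)
    (hb1 : ∀ u : EuclideanSpace ℝ (Fin 3), ‖u‖ ≤ 1 / 2 → b u = 1) :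
    ((M : ℝ) / 4) ^ 3 ≤ ∑ x ∈ Fintype.piFinset (fun _ : Fin 3 => Icc (-(L : ℤ)) (L : ℤ)),
      b (WithLp.toLp 2 fun j => (x j : ℝ) / (M : ℝ)) ^ 2 := by
  set t : ℕ := M / 4 with ht
  have ht4 : 4 * t ≤ M := Nat.mul_div_le M 4
  have htM : M < 4 * t + 4 := by omega
  set T : Finset (Fin 3 → ℤ) := Fintype.piFinset (fun _ : Fin 3 => Icc (-(t : ℤ)) (t : ℤ)) with hT
  have hsub : T ⊆ Fintype.piFinset (fun _ : Fin 3 => Icc (-(L : ℤ)) (L : ℤ)) := by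
    intro x hx
    rw [hT, Fintype.mem_piFinset] at hx
    rw [Fintype.mem_piFinset]
    intro j
    have := hx j
    simp only [mem_Icc] at this ⊢
    constructor <;> omega
  have hM0 : (0 : ℝ) < M := by exact_mod_cast (show 0 < M by omega)
  -- on the small cube the profile is `1`
  have hone : ∀ x ∈ T, b (WithLp.toLp 2 fun j => (x j : ℝ) / (M : ℝ)) ^ 2 = 1 := by
    intro x hx
    rw [hT, Fintype.mem_piFinset] at hx
    have hxj : ∀ j, |(x j : ℝ)| ≤ t := fun j => by
      have := hx j; simp only [mem_Icc] at this
      rw [abs_le]; constructor <;> exact_mod_cast (by omega : _)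
    have hnorm : ‖(WithLp.toLp 2 fun j => (x j : ℝ) / (M : ℝ) : EuclideanSpace ℝ (Fin 3))‖ ≤ 1 / 2 := by
      rw [EuclideanSpace.norm_eq]
      have hsum : ∑ j : Fin 3, ‖((x j : ℝ) / (M : ℝ))‖ ^ 2 ≤ 3 * ((t : ℝ) / M) ^ 2 := by
        have hle : ∀ j : Fin 3, ‖((x j : ℝ) / (M : ℝ))‖ ^ 2 ≤ ((t : ℝ) / M) ^ 2 := by
          intro j
          rw [Real.norm_eq_abs, abs_div, abs_of_pos hM0]
          exact pow_le_pow_left₀ (by positivity) (div_le_div_of_nonneg_right (hxj j) hM0.le) 2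
        calc ∑ j : Fin 3, ‖((x j : ℝ) / (M : ℝ))‖ ^ 2 ≤ ∑ _j : Fin 3, ((t : ℝ) / M) ^ 2 := Finset.sum_le_sum fun j _ => hle j
          _ = 3 * ((t : ℝ) / M) ^ 2 := by simp
      have htq : (t : ℝ) / M ≤ 1 / 4 := by
        rw [div_le_iff₀ hM0]
        have : (4 * t : ℝ) ≤ M := by exact_mod_cast ht4
        linarith
      have h3 : 3 * ((t : ℝ) / M) ^ 2 ≤ (1 / 2) ^ 2 := by nlinarith [div_nonneg (Nat.cast_nonneg t) hM0.le]
      calc Real.sqrt (∑ j : Fin 3, ‖((x j : ℝ) / (M : ℝ))‖ ^ 2) ≤ Real.sqrt ((1 / 2) ^ 2) :=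
            Real.sqrt_le_sqrt (hsum.trans h3)
        _ = 1 / 2 := Real.sqrt_sq (by norm_num)
    rw [hb1 _ hnorm, one_pow]
  have hcard : (T.card : ℝ) = (2 * (t : ℝ) + 1) ^ 3 := by
    rw [hT, Fintype.card_piFinset, Finset.prod_const, Finset.card_univ, Fintype.card_fin, Int.card_Icc]
    have : ((t : ℤ) + 1 - -(t : ℤ)).toNat = 2 * t + 1 := by omega
    rw [this]; push_cast; ring
  calc ((M : ℝ) / 4) ^ 3 ≤ (2 * (t : ℝ) + 1) ^ 3 := by
        apply pow_le_pow_left₀ (by positivity)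
        have : (M : ℝ) < 4 * t + 4 := by exact_mod_cast htM
        linarith
    _ = ∑ x ∈ T, b (WithLp.toLp 2 fun j => (x j : ℝ) / (M : ℝ)) ^ 2 := by
        rw [Finset.sum_congr rfl hone, Finset.sum_const, nsmul_eq_mul, mul_one, hcard]
    _ ≤ ∑ x ∈ Fintype.piFinset (fun _ : Fin 3 => Icc (-(L : ℤ)) (L : ℤ)), b (WithLp.toLp 2 fun j => (x j : ℝ) / (M : ℝ)) ^ 2 :=
        Finset.sum_le_sum_of_subset_of_nonneg hsub fun x _ _ => sq_nonneg _

end Summit.QuantumFields.YangMills.Theorems.SlackWindowPlancherelCovering
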